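import Literature.Analysis.TotalPositivity.PolyaFrequencyFunctionsProofs
import Literature.Analysis.TotalPositivity.PolyaFrequencyDecay
import Literature.Analysis.TotalPositivity.PolyaFrequencyVariationDiminishing
import Mathlib.Algebra.Polynomial.Taylor
import Mathlib.Algebra.Polynomial.HasseDeriv
import Mathlib.Algebra.Polynomial.Roots
import Mathlib.RingTheory.PowerSeries.Inverse
import Mathlib.Analysis.Complex.Exponential
import Mathlib.Topology.Algebra.Polynomial
import HarnessLib

/-!
# The convolution transform of a Pólya frequency function on polynomials (Schoenberg 1951,
necessity half, step N3a)

Trunk `Literature/Analysis/TotalPositivity`, twelfth proofs file accompanying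
`PolyaFrequencyFunctions.lean` (the named fact `schoenberg1951_pf_laplace`).  For a Pólya
frequency function `Λ` (exponentially decaying, `PolyaFrequencyDecay.lean`) the convolution
transform `f ↦ Λ ⋆ f`, `(Λ ⋆ f)(x) = ∫ Λ(t) f(x − t) dt`, acts on real polynomials, and in the
basis of Hasse derivatives `H_k = D^k/k!` it is the operator with constant coefficients

> `T_c f = Σ_k c_k H_k f`, `c_k = ∫ (−t)^k Λ(t) dt`   (`eval_hasseSum_eq_integral`)

whose symbol `Σ_k c_k s^k/k! = ∫ e^{−st}Λ(t)dt` is the bilateral Laplace transform of `Λ`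
[Schoenberg1951, §8; Hirschman–Widder 1955, Ch. II §7 ("`E(D)`")].  Contents:

* integrability of polynomials against exponentially decaying kernels
  (`abs_pow_le_factorial_mul_exp`, `IsPolyaFrequencyFun.integrable_mul_polynomial`,
  `IsPolyaFrequencyFun.integrable_mul_polynomial'`);
* the Hasse-derivative expansion of the transform (`eval_hasseSum_eq_integral`);
* the algebra of the operators `Σ_k c_k H_k` (`hasseSum_comp`: composition is the binomial
  convolution of the coefficient sequences; `exists_binomial_inverse`: inverse coefficients via
  the exponential generating power series);
* sign structure of real polynomials: strict alternation at `n + 1` points around `n` distinct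
  real roots (`exists_alternation_of_prod_X_sub_C`), and constancy of sign on the complementary
  intervals of the real roots (`exists_sign_on_block`).

## References

* I. J. Schoenberg, *On Pólya frequency functions. I*, J. Analyse Math. 1 (1951) 331–374, §8.
  [Schoenberg1951]
* I. I. Hirschman, D. V. Widder, *The Convolution Transform*, Princeton 1955, Ch. II §7,
  Ch. IV §§2–4. [folklore]
-/

noncomputable section

open MeasureTheory Set Filter Finset Polynomial
open scoped Topology Polynomial

namespace Literature.Analysis.TotalPositivity

/-! ### Integrability of polynomials against exponentially decaying kernels -/

/-- `|t|^k ≤ k! b^{−k} e^{b|t|}` for `b > 0`. [folklore] -/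
theorem abs_pow_le_factorial_mul_exp {b : ℝ} (hb : 0 < b) (k : ℕ) (t : ℝ) :
    |t| ^ k ≤ (Nat.factorial k : ℝ) * b⁻¹ ^ k * Real.exp (b * |t|) := by
  have h := Real.pow_div_factorial_le_exp (b * |t|) (mul_nonneg hb.le (abs_nonneg t)) k
  rw [div_le_iff₀ (by positivity), mul_pow] at h
  have hbk : 0 < b ^ k := pow_pos hb k
  calc |t| ^ k = b⁻¹ ^ k * (b ^ k * |t| ^ k) := by
        rw [← mul_assoc, ← mul_pow, inv_mul_cancel₀ hb.ne', one_pow, one_mul]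
    _ ≤ b⁻¹ ^ k * (Real.exp (b * |t|) * Nat.factorial k) :=
        mul_le_mul_of_nonneg_left h (by positivity)
    _ = (Nat.factorial k : ℝ) * b⁻¹ ^ k * Real.exp (b * |t|) := by ring

/-- A real polynomial is dominated by an exponential: `|p(t)| ≤ A e^{b|t|}` for any `b > 0`.
[folklore] -/
theorem exists_abs_eval_le_exp (p : ℝ[X]) {b : ℝ} (hb : 0 < b) :
    ∃ A : ℝ, 0 ≤ A ∧ ∀ t : ℝ, |p.eval t| ≤ A * Real.exp (b * |t|) := by
  refine ⟨∑ k ∈ Finset.range (p.natDegree + 1), |p.coeff k| * ((Nat.factorial k : ℝ) * b⁻¹ ^ k),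
    Finset.sum_nonneg fun k _ => by positivity, fun t => ?_⟩
  rw [Polynomial.eval_eq_sum_range, Finset.sum_mul]
  refine (Finset.abs_sum_le_sum_abs _ _).trans (Finset.sum_le_sum fun k _ => ?_)
  rw [abs_mul, abs_pow, mul_assoc]
  refine mul_le_mul_of_nonneg_left ?_ (abs_nonneg _)
  exact abs_pow_le_factorial_mul_exp hb k t

/-- **Polynomials are integrable against a Pólya frequency function**: `t ↦ Λ(c − t) p(t)` is
integrable for every real polynomial `p` and every `c` (exponential decay of `Λ`).
[cite: Schoenberg1951, §8] [folklore] -/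
theorem IsPolyaFrequencyFun.integrable_mul_polynomial {Λ : ℝ → ℝ} (h : IsPolyaFrequencyFun Λ)
    (p : ℝ[X]) (c : ℝ) : Integrable fun t => Λ (c - t) * p.eval t := by
  obtain ⟨η, hη, C, hC0, hdecay⟩ := h.exists_exp_decay
  obtain ⟨A, hA0, hA⟩ := exists_abs_eval_le_exp p (half_pos hη)
  have hint : Integrable fun t : ℝ => C * Real.exp (η * |c|) * A * Real.exp (-(η / 2 * |t|)) :=
    (integrable_exp_neg_mul_abs (half_pos hη)).const_mul _
  refine hint.mono' ?_ (Eventually.of_forall fun t => ?_)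
  · exact ((h.measurable.comp (measurable_const.sub measurable_id)).mul
      (Polynomial.continuous p).measurable).aestronglyMeasurable
  · rw [Real.norm_eq_abs, abs_mul, abs_of_nonneg (h.nonneg _)]
    have h1 := hdecay (c - t)
    have h2 := hA t
    have h3 : Real.exp (-(η * |c - t|)) ≤ Real.exp (η * |c|) * Real.exp (-(η * |t|)) := by
      rw [← Real.exp_add, Real.exp_le_exp]
      have : |t| - |c| ≤ |c - t| := by
        have := abs_sub_abs_le_abs_sub t c
        rwa [abs_sub_comm] at this
      nlinarith
    calc Λ (c - t) * |p.eval t| ≤ (C * Real.exp (-(η * |c - t|))) * (A * Real.exp (η / 2 * |t|)) :=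
          mul_le_mul h1 h2 (abs_nonneg _) (mul_nonneg hC0 (Real.exp_pos _).le)
      _ ≤ (C * (Real.exp (η * |c|) * Real.exp (-(η * |t|)))) * (A * Real.exp (η / 2 * |t|)) :=
          mul_le_mul_of_nonneg_right (mul_le_mul_of_nonneg_left h3 hC0) (by positivity)
      _ = C * Real.exp (η * |c|) * A * Real.exp (-(η / 2 * |t|)) := by
          have : Real.exp (-(η * |t|)) * Real.exp (η / 2 * |t|) = Real.exp (-(η / 2 * |t|)) := by
            rw [← Real.exp_add]
            congr 1
            ring
          calc C * (Real.exp (η * |c|) * Real.exp (-(η * |t|))) * (A * Real.exp (η / 2 * |t|))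
              = C * Real.exp (η * |c|) * A * (Real.exp (-(η * |t|)) * Real.exp (η / 2 * |t|)) := by ring
            _ = _ := by rw [this]

/-- The symmetric form: `t ↦ Λ(t) p(x − t)` is integrable. [folklore] -/
theorem IsPolyaFrequencyFun.integrable_mul_polynomial' {Λ : ℝ → ℝ} (h : IsPolyaFrequencyFun Λ)
    (p : ℝ[X]) (x : ℝ) : Integrable fun t => Λ t * p.eval (x - t) := by
  have h1 := h.integrable_mul_polynomial p x
  have h2 := h1.comp_sub_left x
  refine h2.congr (Eventually.of_forall fun t => ?_)
  simp only [sub_sub_cancel]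

/-- Powers are integrable against a Pólya frequency function: `t ↦ (−t)^k Λ(t)`. [folklore] -/
theorem IsPolyaFrequencyFun.integrable_neg_pow_mul {Λ : ℝ → ℝ} (h : IsPolyaFrequencyFun Λ) (k : ℕ) :
    Integrable fun t => (-t) ^ k * Λ t := by
  have h1 := h.integrable_mul_polynomial' (Polynomial.X ^ k) 0
  refine h1.congr (Eventually.of_forall fun t => ?_)
  simp only [Polynomial.eval_pow, Polynomial.eval_X, zero_sub]
  ring

/-! ### The transform in the Hasse basis -/

/-- **The convolution transform on polynomials** (Schoenberg's `Λ ⋆ f`; Hirschman–Widder's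
`E(D)`): for a Pólya frequency function `Λ`, a real polynomial `f` with `deg f ≤ n`, and every `x`,
`∫ Λ(t) f(x − t) dt = (Σ_{k ≤ n} c_k H_k f)(x)` with `c_k = ∫ (−t)^k Λ(t) dt` and `H_k = D^k/k!`
the Hasse derivatives. [cite: Schoenberg1951, §8] -/
theorem IsPolyaFrequencyFun.eval_hasseSum_eq_integral {Λ : ℝ → ℝ} (h : IsPolyaFrequencyFun Λ)
    {c : ℕ → ℝ} (hc : ∀ k, c k = ∫ t, (-t) ^ k * Λ t) {n : ℕ} {f : ℝ[X]} (hf : f.natDegree ≤ n)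
    (x : ℝ) :
    (∑ k ∈ Finset.range (n + 1), c k • Polynomial.hasseDeriv k f).eval x = ∫ t, Λ t * f.eval (x - t) := by
  -- Taylor expansion of `f(x - t)` in powers of `-t`
  have htaylor : ∀ t : ℝ, f.eval (x - t) =
      ∑ k ∈ Finset.range (n + 1), (Polynomial.hasseDeriv k f).eval x * (-t) ^ k := by
    intro t
    have h1 : f.eval (x - t) = (Polynomial.taylor x f).eval (-t) := by
      rw [Polynomial.taylor_eval]
      congr 1
      ring
    rw [h1, Polynomial.eval_eq_sum_range' (n := n + 1)
      (by rw [Polynomial.natDegree_taylor]; omega)]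
    refine Finset.sum_congr rfl fun k _ => ?_
    rw [Polynomial.taylor_coeff]
  simp_rw [htaylor, Finset.mul_sum]
  rw [integral_finsetSum _ (fun k _ => ?_)]
  · rw [Polynomial.eval_finsetSum]
    refine Finset.sum_congr rfl fun k _ => ?_
    rw [Polynomial.eval_smul, smul_eq_mul, hc k, mul_comm, ← integral_const_mul]
    congr 1
    funext t
    ring
  · have := (h.integrable_neg_pow_mul k).const_mul ((Polynomial.hasseDeriv k f).eval x)
    refine this.congr (Eventually.of_forall fun t => ?_)
    simp only
    ring

/-! ### The algebra of the operators `Σ_k c_k H_k` -/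

/-- Beyond the degree the Hasse sum may be truncated anywhere. [folklore] -/
theorem hasseSum_eq_of_le {c : ℕ → ℝ} {n n' : ℕ} {f : ℝ[X]} (hf : f.natDegree ≤ n) (hn : n ≤ n') :
    ∑ k ∈ Finset.range (n' + 1), c k • Polynomial.hasseDeriv k f =
      ∑ k ∈ Finset.range (n + 1), c k • Polynomial.hasseDeriv k f := by
  refine (Finset.sum_subset (Finset.range_subset_range.2 (by omega)) fun k hk hk' => ?_).symm
  rw [Finset.mem_range] at hk hk'
  rw [Polynomial.hasseDeriv_eq_zero_of_lt_natDegree _ _ (by omega), smul_zero]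

/-- The Hasse sum does not raise the degree. [folklore] -/
theorem natDegree_hasseSum_le {c : ℕ → ℝ} {n : ℕ} {f : ℝ[X]} (hf : f.natDegree ≤ n) :
    (∑ k ∈ Finset.range (n + 1), c k • Polynomial.hasseDeriv k f).natDegree ≤ n := by
  refine Polynomial.natDegree_sum_le_of_forall_le _ _ fun k _ => ?_
  exact (Polynomial.natDegree_smul_le _ _).trans
    ((Polynomial.natDegree_hasseDeriv_le _ _).trans ((Nat.sub_le _ _).trans hf))

/-- **Composition of Hasse sums is the binomial convolution of the coefficients**:
`(Σ_i c_i H_i)(Σ_j d_j H_j) f = Σ_k (Σ_{i+j=k} C(k,i) c_i d_j) H_k f` for `deg f ≤ n` (using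
`H_i H_j = C(i+j, i) H_{i+j}`). [folklore] -/
theorem hasseSum_comp {c d : ℕ → ℝ} {n : ℕ} {f : ℝ[X]} (hf : f.natDegree ≤ n) :
    ∑ i ∈ Finset.range (n + 1), c i • Polynomial.hasseDeriv i
        (∑ j ∈ Finset.range (n + 1), d j • Polynomial.hasseDeriv j f) =
      ∑ k ∈ Finset.range (n + 1),
        (∑ p ∈ Finset.antidiagonal k, ((k.choose p.1 : ℕ) : ℝ) * c p.1 * d p.2) •
          Polynomial.hasseDeriv k f := by
  -- expand the double sum
  have hexp : ∑ i ∈ Finset.range (n + 1), c i • Polynomial.hasseDeriv i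
      (∑ j ∈ Finset.range (n + 1), d j • Polynomial.hasseDeriv j f) =
      ∑ i ∈ Finset.range (n + 1), ∑ j ∈ Finset.range (n + 1),
        ((((i + j).choose i : ℕ) : ℝ) * c i * d j) • Polynomial.hasseDeriv (i + j) f := by
    refine Finset.sum_congr rfl fun i _ => ?_
    rw [map_sum, Finset.smul_sum]
    refine Finset.sum_congr rfl fun j _ => ?_
    rw [LinearMap.map_smul_of_tower]
    have hcomp := congrArg (fun L : ℝ[X] →ₗ[ℝ] ℝ[X] => L f) (Polynomial.hasseDeriv_comp (R := ℝ) i j)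
    simp only [LinearMap.coe_comp, Function.comp_apply, LinearMap.smul_apply] at hcomp
    rw [hcomp, ← Nat.cast_smul_eq_nsmul ℝ, smul_smul, smul_smul]
    congr 1
    ring
  rw [hexp]
  -- pass to the sum over all pairs and regroup along antidiagonals
  rw [← Finset.sum_product']
  -- pairs with `i + j > n` contribute nothing
  have hzero : ∀ q ∈ Finset.range (n + 1) ×ˢ Finset.range (n + 1), n < q.1 + q.2 →
      ((((q.1 + q.2).choose q.1 : ℕ) : ℝ) * c q.1 * d q.2) • Polynomial.hasseDeriv (q.1 + q.2) f = 0 := by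
    intro q _ hq
    rw [Polynomial.hasseDeriv_eq_zero_of_lt_natDegree _ _ (lt_of_le_of_lt hf hq), smul_zero]
  rw [← Finset.sum_filter_add_sum_filter_not _ (fun q : ℕ × ℕ => q.1 + q.2 ≤ n)]
  rw [Finset.sum_eq_zero (s := Finset.filter (fun q : ℕ × ℕ => ¬ q.1 + q.2 ≤ n) _) (fun q hq => by
    rw [Finset.mem_filter] at hq
    exact hzero q hq.1 (not_le.1 hq.2)), add_zero]
  -- the remaining pairs are the disjoint union of the antidiagonals `k ≤ n`
  have hset : (Finset.range (n + 1) ×ˢ Finset.range (n + 1)).filter (fun q : ℕ × ℕ => q.1 + q.2 ≤ n) =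
      (Finset.range (n + 1)).biUnion fun k => Finset.antidiagonal k := by
    ext q
    simp only [Finset.mem_filter, Finset.mem_product, Finset.mem_range, Finset.mem_biUnion,
      Finset.mem_antidiagonal]
    constructor
    · rintro ⟨-, hq⟩
      exact ⟨q.1 + q.2, by omega, rfl⟩
    · rintro ⟨k, hk, hq⟩
      omega
  rw [hset, Finset.sum_biUnion]
  · refine Finset.sum_congr rfl fun k _ => ?_
    rw [Finset.sum_smul]
    refine Finset.sum_congr rfl fun q hq => ?_
    rw [Finset.mem_antidiagonal] at hq
    rw [hq]
  · intro k _ k' _ hkk'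
    simp only [Function.onFun]
    rw [Finset.disjoint_left]
    intro q hq hq'
    rw [Finset.mem_antidiagonal] at hq hq'
    exact hkk' (hq.symm.trans hq')

/-- **Inverse coefficients** (via the exponential generating power series): if `c₀ ≠ 0` there is
`d` with `Σ_{i+j=k} C(k,i) c_i d_j = δ_{k0}`, namely `d_k = k! [s^k] (Σ_j c_j s^j/j!)⁻¹`; the
`d_k` are the Taylor coefficients (times `k!`) of the reciprocal of the symbol. [folklore] -/
theorem exists_binomial_inverse {c : ℕ → ℝ} (hc : c 0 ≠ 0) :
    ∃ d : ℕ → ℝ, (∀ k, d k = (Nat.factorial k : ℝ) *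
        PowerSeries.coeff k (PowerSeries.mk fun j => c j / (Nat.factorial j : ℝ))⁻¹) ∧
      ∀ k, ∑ p ∈ Finset.antidiagonal k, ((k.choose p.1 : ℕ) : ℝ) * c p.1 * d p.2 =
        if k = 0 then 1 else 0 := by
  set F : PowerSeries ℝ := PowerSeries.mk fun j => c j / (Nat.factorial j : ℝ) with hF
  have hF0 : PowerSeries.constantCoeff F ≠ 0 := by
    rw [hF, PowerSeries.constantCoeff_mk]
    simpa using hc
  refine ⟨fun k => (Nat.factorial k : ℝ) * PowerSeries.coeff k F⁻¹, fun k => rfl, fun k => ?_⟩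
  have hmul := congrArg (PowerSeries.coeff k) (PowerSeries.mul_inv_cancel F hF0)
  rw [PowerSeries.coeff_mul, PowerSeries.coeff_one] at hmul
  have hterm : ∀ p ∈ Finset.antidiagonal k, ((k.choose p.1 : ℕ) : ℝ) * c p.1 *
      ((Nat.factorial p.2 : ℝ) * PowerSeries.coeff p.2 F⁻¹) =
      (Nat.factorial k : ℝ) * (PowerSeries.coeff p.1 F * PowerSeries.coeff p.2 F⁻¹) := by
    intro p hp
    rw [Finset.mem_antidiagonal] at hp
    rw [hF, PowerSeries.coeff_mk]
    have hchoose : (Nat.factorial k : ℝ) =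
        ((k.choose p.1 : ℕ) : ℝ) * ((Nat.factorial p.1 : ℝ) * (Nat.factorial p.2 : ℝ)) := by
      rw [← hp]
      have h1 := Nat.add_choose_mul_factorial_mul_factorial p.1 p.2
      rw [← Nat.choose_symm_add] at h1
      rw [← h1]
      push_cast
      ring
    rw [hchoose]
    field_simp
  rw [Finset.sum_congr rfl hterm, ← Finset.mul_sum, hmul]
  split_ifs with hk
  · subst hk
    simp
  · simp

/-! ### Sign structure of real polynomials -/

/-- **Alternation around distinct real roots**: for `ρ₀ < ⋯ < ρ_{n−1}` and `C₀ ≠ 0` the polynomial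
`C₀ ∏ (X − ρ_j)` alternates strictly in sign at `n + 1` strictly increasing points (one in each
complementary interval of the roots). [folklore] -/
theorem exists_alternation_of_prod_X_sub_C {n : ℕ} {ρ : Fin n → ℝ} (hρ : StrictMono ρ) {C₀ : ℝ}
    (hC : C₀ ≠ 0) :
    ∃ z : Fin (n + 1) → ℝ, StrictMono z ∧ ∀ i : Fin n,
      (Polynomial.C C₀ * ∏ j, (Polynomial.X - Polynomial.C (ρ j))).eval (z i.castSucc) *
        (Polynomial.C C₀ * ∏ j, (Polynomial.X - Polynomial.C (ρ j))).eval (z i.succ) < 0 := by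
  classical
  -- one point in each block
  have hex : ∀ i : Fin (n + 1), ∃ t : ℝ, ∀ k : Fin n, ((k : ℕ) < (i : ℕ) → ρ k < t) ∧
      ((i : ℕ) ≤ (k : ℕ) → t < ρ k) := fun i => block_nonempty hρ (Nat.le_of_lt_succ i.2)
  choose z hz using hex
  refine ⟨z, fun i i' hii' => lt_of_block_lt_block (Fin.lt_def.1 hii') (Nat.le_of_lt_succ i'.2)
    (hz i) (hz i'), fun i => ?_⟩
  have heval : ∀ t : ℝ, (Polynomial.C C₀ * ∏ j, (Polynomial.X - Polynomial.C (ρ j))).eval t =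
      C₀ * ∏ j, (t - ρ j) := by
    intro t
    rw [Polynomial.eval_mul, Polynomial.eval_C, Polynomial.eval_prod]
    simp only [Polynomial.eval_sub, Polynomial.eval_X, Polynomial.eval_C]
  rw [heval, heval]
  set a := z i.castSucc with ha
  set b := z i.succ with hb
  have hprod : (C₀ * ∏ j, (a - ρ j)) * (C₀ * ∏ j, (b - ρ j)) =
      C₀ ^ 2 * (((a - ρ i) * (b - ρ i)) * ∏ j ∈ Finset.univ.erase i, ((a - ρ j) * (b - ρ j))) := by
    rw [Finset.mul_prod_erase _ (fun j => (a - ρ j) * (b - ρ j)) (Finset.mem_univ i),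
      Finset.prod_mul_distrib]
    ring
  rw [hprod]
  have h1 : a - ρ i < 0 := by
    have := ((hz i.castSucc) i).2 (by simp)
    rw [ha]
    linarith
  have h2 : 0 < b - ρ i := by
    have := ((hz i.succ) i).1 (by simp)
    rw [hb]
    linarith
  have h3 : 0 < ∏ j ∈ Finset.univ.erase i, ((a - ρ j) * (b - ρ j)) := by
    refine Finset.prod_pos fun j hj => ?_
    have hji : j ≠ i := Finset.ne_of_mem_erase hj
    rcases lt_or_gt_of_ne (fun h : (j : ℕ) = (i : ℕ) => hji (Fin.ext h)) with hlt | hlt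
    · have hja := ((hz i.castSucc) j).1 (by simpa using hlt)
      have hjb := ((hz i.succ) j).1 (by simp; omega)
      rw [ha, hb]
      nlinarith
    · have hja := ((hz i.castSucc) j).2 (by simp; omega)
      have hjb := ((hz i.succ) j).2 (by simp; omega)
      rw [ha, hb]
      nlinarith
  have h4 : (a - ρ i) * (b - ρ i) < 0 := mul_neg_of_neg_of_pos h1 h2
  have hC2 : 0 < C₀ ^ 2 := by positivity
  nlinarith [mul_pos hC2 (mul_pos (neg_pos.2 h4) h3)]

/-- Points of a block are not among the `r_k`. [folklore] -/
theorem not_mem_range_of_block {m : ℕ} {r : Fin m → ℝ} {j : ℕ} {t : ℝ}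
    (ht : ∀ k : Fin m, ((k : ℕ) < j → r k < t) ∧ (j ≤ (k : ℕ) → t < r k)) : t ∉ Set.range r := by
  rintro ⟨k, rfl⟩
  rcases lt_or_ge (k : ℕ) j with h | h
  · exact lt_irrefl _ ((ht k).1 h)
  · exact lt_irrefl _ ((ht k).2 h)

/-- Blocks are convex: a point between two points of a block lies in the block. [folklore] -/
theorem block_of_mem_uIcc {m : ℕ} {r : Fin m → ℝ} {j : ℕ} {t t' s : ℝ}
    (ht : ∀ k : Fin m, ((k : ℕ) < j → r k < t) ∧ (j ≤ (k : ℕ) → t < r k))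
    (ht' : ∀ k : Fin m, ((k : ℕ) < j → r k < t') ∧ (j ≤ (k : ℕ) → t' < r k)) (hs : s ∈ Set.uIcc t t') :
    ∀ k : Fin m, ((k : ℕ) < j → r k < s) ∧ (j ≤ (k : ℕ) → s < r k) := by
  rw [Set.mem_uIcc] at hs
  intro k
  constructor
  · intro hk
    have h1 := (ht k).1 hk
    have h2 := (ht' k).1 hk
    rcases hs with ⟨h3, -⟩ | ⟨h3, -⟩ <;> linarith
  · intro hk
    have h1 := (ht k).2 hk
    have h2 := (ht' k).2 hk
    rcases hs with ⟨-, h3⟩ | ⟨-, h3⟩ <;> linarith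

/-- **Constant sign on the complementary intervals of the real roots**: if every real root of the
real polynomial `f` is among `r₀ < ⋯ < r_{m−1}`, then on each block `f` has a constant strict sign
`ε ∈ {±1}` (intermediate value theorem). [folklore] -/
theorem exists_sign_on_block (f : ℝ[X]) {m : ℕ} {r : Fin m → ℝ} (hr : StrictMono r)
    (hroots : ∀ t : ℝ, f.eval t = 0 → t ∈ Set.range r) {j : ℕ} (hj : j ≤ m) :
    ∃ ε : ℝ, (ε = 1 ∨ ε = -1) ∧ ∀ t : ℝ,
      (∀ k : Fin m, ((k : ℕ) < j → r k < t) ∧ (j ≤ (k : ℕ) → t < r k)) → 0 < ε * f.eval t := by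
  obtain ⟨t₀, ht₀⟩ := block_nonempty hr hj
  have hne : ∀ t : ℝ, (∀ k : Fin m, ((k : ℕ) < j → r k < t) ∧ (j ≤ (k : ℕ) → t < r k)) → f.eval t ≠ 0 :=
    fun t ht h0 => not_mem_range_of_block ht (hroots t h0)
  refine ⟨if 0 < f.eval t₀ then 1 else -1, by split_ifs <;> simp, fun t ht => ?_⟩
  -- no root between `t₀` and `t`, so the signs agree
  have hnoroot : ∀ s ∈ Set.uIcc t₀ t, f.eval s ≠ 0 := fun s hs => hne s (block_of_mem_uIcc ht₀ ht hs)
  have hcont : ContinuousOn (fun s => f.eval s) (Set.uIcc t₀ t) := (Polynomial.continuous f).continuousOn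
  have hivt := intermediate_value_uIcc hcont
  by_cases hpos : 0 < f.eval t₀
  · rw [if_pos hpos, one_mul]
    by_contra hle
    push Not at hle
    have h0 : (0 : ℝ) ∈ Set.uIcc (f.eval t₀) (f.eval t) := Set.mem_uIcc.2 (Or.inr ⟨hle, hpos.le⟩)
    obtain ⟨s, hs, hs0⟩ := hivt h0
    exact hnoroot s hs hs0
  · rw [if_neg hpos]
    have hneg : f.eval t₀ < 0 := lt_of_le_of_ne (not_lt.1 hpos) (hne t₀ ht₀)
    by_contra hle
    push Not at hle
    have hle' : 0 ≤ f.eval t := by linarith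
    have h0 : (0 : ℝ) ∈ Set.uIcc (f.eval t₀) (f.eval t) := Set.mem_uIcc.2 (Or.inl ⟨hneg.le, hle'⟩)
    obtain ⟨s, hs, hs0⟩ := hivt h0
    exact hnoroot s hs hs0

end Literature.Analysis.TotalPositivity

end
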